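import Mathlib
import Summits.MatrixMultiplication.MatrixMultiplication.Theorems.SevenEighthsLaw.Negative.SharpConstants

/-!
# `SevenEighthsLaw` — negative-side lemma, cycle 3: the hard stub needs product-spannedness

Load-bearing analysis (cdisprove seat, crux stmt-MatrixMultiplication-4959) of the lead's load-bearing stub
`stub_capHardRegime` of line `Cruxes/SevenEighthsLaw/Lines/singlet-fraction-transfer.lean`:

  `stub_capHardRegime : ∀ u v e, (e orthonormal 6-frame of X ⊗ Y) → (e ⊂ span of the six products u_l ⊗ v_l) →
     3 < dim span {m(e_s)} → cap e ≤ 7`,   `cap e = Σ_s Σ_a |Σ_μ e_s (a.1,μ) (μ,a.2)|² = 2·tr(P_E Π_W)`.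

`sevenEighthsLaw_capHardRegime_false_without_productSpan`: with the product-span hypothesis DROPPED the stub is
false — the orthonormal frame `wFrame` = {`(δ₀₀ ± δ₁₁) ⊗ I₂ / 2`, `(δ₀₁ ± δ₁₀) ⊗ I₂ / 2`} ∪ {two unit vectors with
`b.2 ≠ c.1`} contains the whole slice space `W = {q ⊗ I₂}` of `⟨2,2,2⟩`, lies in the hard regime (its multiplied
vectors span `ℂ^{P2}`, `finrank = 4`) and has `cap = 8 > 7` (`SevenEighthsLawNeg.cap_wFrame`).  So any proof of the
hard stub must use that `E` is spanned by six rank-one matrices — `W ⊄ E` for such `E` is exactly `R/bR(⟨2,2,2⟩) > 6`,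
the entry point, not a by-product.  (The other two hypotheses are not load-bearing in the same sense: without
orthonormality the statement is scale-false trivially, and without `3 < finrank` it is the full E-picture of the
crux, cap `≤ 6` holding in the easy regime by `stub_capEasyRegime`.)  No Theses statement is asserted here.
-/

namespace Summit.MatrixMultiplication.MatrixMultiplication.Theorems

open scoped BigOperators ComplexConjugate

namespace SevenEighthsLawNeg

/-- Twice the witness frame, over `ℤ`: rows 0–3 are `(δ₀₀ ± δ₁₁) ⊗ I₂`, `(δ₀₁ ± δ₁₀) ⊗ I₂` (an orthogonal basis
of the slice space `W = {q ⊗ I₂}` of `⟨2,2,2⟩` in `X ⊗ Y`, `b = (κ,μ)`, `c = (μ',ν)`, each of squared norm 4),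
rows 4–5 are `2·δ_{(0,0)} ⊗ δ_{(1,0)}` and `2·δ_{(0,0)} ⊗ δ_{(1,1)}` (outside `W`: `b.2 ≠ c.1`). [folklore] -/
def wTab (s : Fin 6) (b c : P2) : ℤ :=
  match s with
  | 0 => if b.2 = c.1 ∧ b.1 = c.2 then 1 else 0
  | 1 => if b.2 = c.1 ∧ b.1 = c.2 then (if b.1 = 0 then 1 else -1) else 0
  | 2 => if b.2 = c.1 ∧ b.1 ≠ c.2 then 1 else 0
  | 3 => if b.2 = c.1 ∧ b.1 ≠ c.2 then (if b.1 = 0 then 1 else -1) else 0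
  | 4 => if b = (0, 0) ∧ c = (1, 0) then 2 else 0
  | 5 => if b = (0, 0) ∧ c = (1, 1) then 2 else 0

/-- The witness frame `wFrame = wTab / 2 : Fin 6 → X ⊗ Y`. [folklore] -/
noncomputable def wFrame (s : Fin 6) (b c : P2) : ℂ := (wTab s b c : ℂ) / 2

/-- Integer Gram matrix of `wTab`: `4·I₆`. [folklore] -/
theorem wTab_gram : ∀ s t : Fin 6, (∑ b, ∑ c, wTab s b c * wTab t b c) = if s = t then 4 else 0 := by
  decide

/-- `wFrame` is an orthonormal 6-frame. [folklore] -/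
theorem wFrame_orthonormal (s t : Fin 6) :
    (∑ b, ∑ c, conj (wFrame s b c) * wFrame t b c) = if s = t then 1 else 0 := by
  have h : (∑ b, ∑ c, conj (wFrame s b c) * wFrame t b c)
      = ((∑ b, ∑ c, wTab s b c * wTab t b c : ℤ) : ℂ) / 4 := by
    unfold wFrame
    push_cast
    rw [Finset.sum_div]
    refine Finset.sum_congr rfl fun b _ => ?_
    rw [Finset.sum_div]
    refine Finset.sum_congr rfl fun c _ => ?_
    simp only [map_div₀, map_intCast, map_ofNat]
    ring
  rw [h, wTab_gram s t]
  split_ifs <;> norm_num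

/-- The multiplied vectors `m(wFrame s)(a) = Σ_μ wFrame s (a.1,μ) (μ,a.2)`: `δ₀₀ ± δ₁₁`, `δ₀₁ ± δ₁₀`, `0`, `0`.
[folklore] -/
def mvTab (s : Fin 6) (a : P2) : ℤ :=
  match s with
  | 0 => if a.1 = a.2 then 1 else 0
  | 1 => if a.1 = a.2 then (if a.1 = 0 then 1 else -1) else 0
  | 2 => if a.1 ≠ a.2 then 1 else 0
  | 3 => if a.1 ≠ a.2 then (if a.1 = 0 then 1 else -1) else 0
  | 4 => 0
  | 5 => 0

/-- `Σ_μ wTab s (a.1,μ) (μ,a.2) = 2·mvTab s a`. [folklore] -/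
theorem mTab_eq : ∀ s : Fin 6, ∀ a : P2, (∑ μ : Fin 2, wTab s (a.1, μ) (μ, a.2)) = 2 * mvTab s a := by
  decide

/-- Closed form of the multiplied vectors of `wFrame`. [folklore] -/
theorem mv_eq (s : Fin 6) (a : P2) : (∑ μ : Fin 2, wFrame s (a.1, μ) (μ, a.2)) = (mvTab s a : ℂ) := by
  have h : (∑ μ : Fin 2, wFrame s (a.1, μ) (μ, a.2))
      = ((∑ μ : Fin 2, wTab s (a.1, μ) (μ, a.2) : ℤ) : ℂ) / 2 := by
    unfold wFrame; push_cast; rw [Finset.sum_div]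
  rw [h, mTab_eq s a]; push_cast; ring

/-- `Σ_s Σ_a mvTab² = 8`. [folklore] -/
theorem mvTab_sq_sum : (∑ s : Fin 6, ∑ a : P2, mvTab s a ^ 2) = 8 := by decide

/-- **`cap wFrame = 8`**: the frame captures all of `⟨2,2,2⟩` (it contains the slice space `W`). [folklore] -/
theorem cap_wFrame : (∑ s, ∑ a : Fin 2 × Fin 2, ‖∑ m : Fin 2, wFrame s (a.1, m) (m, a.2)‖ ^ 2) = 8 := by
  have h : (∑ s, ∑ a : Fin 2 × Fin 2, ‖∑ m : Fin 2, wFrame s (a.1, m) (m, a.2)‖ ^ 2)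
      = ((∑ s : Fin 6, ∑ a : P2, mvTab s a ^ 2 : ℤ) : ℝ) := by
    push_cast
    refine Finset.sum_congr rfl fun s _ => Finset.sum_congr rfl fun a _ => ?_
    rw [mv_eq, Complex.norm_intCast, sq_abs]
  rw [h, mvTab_sq_sum]; norm_num

/-- The multiplied vectors of `wFrame` span all of `ℂ^{P2}` (hard regime). [folklore] -/
theorem span_mv_wFrame_eq_top :
    Submodule.span ℂ (Set.range fun s : Fin 6 => fun a : Fin 2 × Fin 2 => ∑ μ : Fin 2, wFrame s (a.1, μ) (μ, a.2))
      = ⊤ := by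
  set V := Submodule.span ℂ (Set.range fun s : Fin 6 =>
    fun a : Fin 2 × Fin 2 => ∑ μ : Fin 2, wFrame s (a.1, μ) (μ, a.2)) with hV
  have hm : ∀ s : Fin 6, (fun a : P2 => (mvTab s a : ℂ)) ∈ V := by
    intro s
    have h1 : (fun a : Fin 2 × Fin 2 => ∑ μ : Fin 2, wFrame s (a.1, μ) (μ, a.2)) ∈ V :=
      Submodule.subset_span ⟨s, rfl⟩
    convert h1 using 1
    funext a
    exact (mv_eq s a).symm
  have hδ : ∀ a₀ : P2, (fun a : P2 => if a₀ = a then (1 : ℂ) else 0) ∈ V := by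
    intro a₀
    have h01 := V.add_mem (hm 0) (hm 1)
    have h01' := V.sub_mem (hm 0) (hm 1)
    have h23 := V.add_mem (hm 2) (hm 3)
    have h23' := V.sub_mem (hm 2) (hm 3)
    rcases a₀ with ⟨i, j⟩
    fin_cases i <;> fin_cases j
    · convert V.smul_mem (1 / 2 : ℂ) h01 using 1
      funext a; rcases a with ⟨k, l⟩; fin_cases k <;> fin_cases l <;> norm_num [mvTab]
    · convert V.smul_mem (1 / 2 : ℂ) h23 using 1
      funext a; rcases a with ⟨k, l⟩; fin_cases k <;> fin_cases l <;> norm_num [mvTab]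
    · convert V.smul_mem (1 / 2 : ℂ) h23' using 1
      funext a; rcases a with ⟨k, l⟩; fin_cases k <;> fin_cases l <;> norm_num [mvTab]
    · convert V.smul_mem (1 / 2 : ℂ) h01' using 1
      funext a; rcases a with ⟨k, l⟩; fin_cases k <;> fin_cases l <;> norm_num [mvTab]
  refine Submodule.eq_top_iff'.mpr fun v => ?_
  rw [pi_eq_sum_univ v]
  exact V.sum_mem fun a _ => V.smul_mem _ (hδ a)

/-- `finrank span {m(wFrame s)} = 4 > 3`: `wFrame` is in the hard regime of the stub. [folklore] -/
theorem finrank_span_mv_wFrame :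
    Module.finrank ℂ (Submodule.span ℂ (Set.range fun s : Fin 6 =>
      fun a : Fin 2 × Fin 2 => ∑ μ : Fin 2, wFrame s (a.1, μ) (μ, a.2))) = 4 := by
  rw [span_mv_wFrame_eq_top, finrank_top, Module.finrank_fintype_fun_eq_card]
  rfl

end SevenEighthsLawNeg

open SevenEighthsLawNeg

/-- **The hard stub is false without product-spannedness.**  `stub_capHardRegime` of the line
`singlet-fraction-transfer` with its hypothesis `hps : ∀ s, e s ∈ span (u_l ⊗ v_l)` dropped fails at the
orthonormal frame `wFrame` (the slice space `W` of `⟨2,2,2⟩` plus two unit vectors outside it): hard regime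
(`finrank = 4`) and `cap = 8 > 7`.  Hence the product structure of `E` (six rank-one matrices, i.e. the rank bound of
the crux) must enter the proof of the hard stub; `cap = 8 ⟺ W ⊆ E`, excluded for product-spanned `E` exactly by
`R(⟨2,2,2⟩) = 7` (honest) / `bR(⟨2,2,2⟩) = 7` (border). [folklore] -/
theorem sevenEighthsLaw_capHardRegime_false_without_productSpan :
    ¬ (∀ e : Fin 6 → (Fin 2 × Fin 2) → (Fin 2 × Fin 2) → ℂ,
        (∀ s t : Fin 6, (∑ b, ∑ c, conj (e s b c) * e t b c) = if s = t then 1 else 0) →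
        3 < Module.finrank ℂ (Submodule.span ℂ (Set.range fun s : Fin 6 =>
            fun a : Fin 2 × Fin 2 => ∑ μ : Fin 2, e s (a.1, μ) (μ, a.2))) →
        ∑ s, ∑ a : Fin 2 × Fin 2, ‖∑ m : Fin 2, e s (a.1, m) (m, a.2)‖ ^ 2 ≤ 7) := by
  intro h
  have key := h wFrame wFrame_orthonormal (by rw [finrank_span_mv_wFrame]; norm_num)
  rw [cap_wFrame] at key
  norm_num at key

/-- The same witness shows the easy/hard DICHOTOMY constant: an orthonormal frame whose multiplied vectors span
all four dimensions can have capture as large as `8 = 2 · 4` (`cap ≤ 2 · dim span m(e)` is attained), so the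
Bessel bound of `stub_capEasyRegime` gives nothing in the hard regime. [folklore] -/
theorem sevenEighthsLaw_cap_eight_in_hard_regime :
    ∃ e : Fin 6 → (Fin 2 × Fin 2) → (Fin 2 × Fin 2) → ℂ,
      (∀ s t : Fin 6, (∑ b, ∑ c, conj (e s b c) * e t b c) = if s = t then 1 else 0) ∧
      Module.finrank ℂ (Submodule.span ℂ (Set.range fun s : Fin 6 =>
          fun a : Fin 2 × Fin 2 => ∑ μ : Fin 2, e s (a.1, μ) (μ, a.2))) = 4 ∧
      (∑ s, ∑ a : Fin 2 × Fin 2, ‖∑ m : Fin 2, e s (a.1, m) (m, a.2)‖ ^ 2) = 8 :=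
  ⟨wFrame, wFrame_orthonormal, finrank_span_mv_wFrame, cap_wFrame⟩

end Summit.MatrixMultiplication.MatrixMultiplication.Theorems
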